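import Summits.MatrixMultiplication.OmegaCensus.STPP211Z2pow6NFCertsCheck
import Summits.MatrixMultiplication.OmegaCensus.STPP211Z2pow6FrameNF
import Mathlib.Data.List.Sort
import Mathlib.Data.List.Permutation
import Mathlib.Data.List.Sublists

/-!
# (2,1,1)¹⁰ ⊄ (ℤ/2)⁶ — part H3c: the COVER engine (frame normal form ↦ listed canonical set by a coordinate permutation)

Cell `pub-omega` (unit `pub-omega-stpp-1-g37`), topic `Summits/MatrixMultiplication/OmegaCensus`.
HONEST FRAMING (verbatim): lottery ticket; floor = certified bounds/negative ranges. Census STRUCTURE bookkeeping (B5, `T1((ℤ/2)⁶)`, Pb237);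
nothing here is a bound on `ω`.

The COVER step of the normal-form layer (HOME `pub-omega-stpp-1-g36/S3-RECIPE.md`): every FRAME NORMAL FORM `base d ∪ R` (`d ∈ {4,5,6}`,
`R` a `(9 − d)`-subset of `free d`; 44 672 frames, `STPP211Z2pow6FrameNF.exists_frameNF`) is carried by a COORDINATE PERMUTATION of `𝔽₂⁶`
onto one of the 456 canonical code sets `C` listed in `certs` (`STPP211Z2pow6NFCertsData1/2`). This file is the kernel engine and its
reading; the decisions (chunked over the frames) and the assembly with `exists_frameNF` / `certs_spec` are the parts H3d / H4.
* `coverOne d R` (on the free part `R` as a CODE LIST): pick ONE coordinate permutation `bestPerm d R` (column codes; from the ordering of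
  `R` whose column multiset has the lex-least sorted form — the seat's offline canonical form, found as the arg-max of the histogram key
  `colKey`; NOTHING about optimality is used), compute the membership mask `frameMask d R` of the image of the frame (`0`, the first `d`
  columns, and `linI P x` for `x ∈ R` — `linI` = the linear map `linC` as a fold), and CONFIRM that it is the mask of one of the listed `C`
  with this `d` (bucketed table by mask mod 61; equal masks = equal sets, `setOf_eq_of_maskOf_eq`) and that the column list sorts to the
  basis codes. Soundness rests only on the confirmation: `coverOne_spec`. Hot paths call `Nat.*` primitives directly (kernel cost).
* `perms_ok` (kernel, the 720 permutations of the basis codes): each passes `linOK` (so `lin P` is an injective homomorphism,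
  `STPP211Z2pow6NFMapsD`), `linI P = linC P` on codes `< 64`, and the basic codes map to `0 :: P.take d`.
* `mem_free_iff` / `setOf_baseCodes` (kernel): the code lists `freeCodes d` / `baseCodes d` describe `free d` / `base d`.
Offline mirror (seat folder `code/cover_mirror3.py`): all 44 672 frames hit the table.

References: H. Cohn, R. Kleinberg, B. Szegedy, C. Umans, FOCS 2005 (arXiv:math/0511460), Def. 5.1.
-/

namespace Summit.MatrixMultiplication.OmegaCensus

namespace T1Z2p6

open Finset

/-! ## Code lists of the frame -/

/-- Codes of `base d`: `0, 1, 2, …, 2^(d−1)`. -/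
def baseCodes (d : ℕ) : List ℕ := 0 :: (List.range d).map (2 ^ ·)

/-- Codes of `free d` (increasing): codes `< 2ᵈ` that are not basic. -/
def freeCodes (d : ℕ) : List ℕ := (List.range (2 ^ d)).filter fun n => !((baseCodes d).elem n)

/-- The six basis codes. -/
def basis6 : List ℕ := [1, 2, 4, 8, 16, 32]

/-! ## The canonical coordinate permutation of a frame (hot path: `Nat.*` primitives) -/

/-- An ordering `o` of `R` packed six bits per element (`o[j]` at bits `6j …`). -/
def packRows : List ℕ → ℕ
  | [] => 0
  | x :: o => Nat.add (Nat.mul (packRows o) 64) x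

/-- Column `i` of a packed ordering `N`: bit `j` = bit `i` of `o[j]` (`j < 5`; bit-gather by one multiplication, no carries occur). -/
def colP (N i : ℕ) : ℕ := Nat.land (Nat.shiftRight (Nat.mul (Nat.land (Nat.shiftRight N i) 17043521) 17318416) 24) 31

/-- Columns `i, …, i + k − 1` of a packed ordering. -/
def colsGo (N : ℕ) : ℕ → ℕ → List ℕ
  | _, 0 => []
  | i, k + 1 => colP N i :: colsGo N (i + 1) k

/-- The `d` columns of an ordering. -/
def cols (d : ℕ) (o : List ℕ) : List ℕ := colsGo (packRows o) 0 d

/-- The histogram key `Σ 8^(K − colᵢ)` over columns `i, …, i + k − 1`: larger key = lex-smaller sorted column tuple. -/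
def keyGo (N K : ℕ) : ℕ → ℕ → ℕ
  | _, 0 => 0
  | i, k + 1 => Nat.add (Nat.pow 8 (Nat.sub K (colP N i))) (keyGo N K (i + 1) k)

/-- The key of an ordering (`K = 2^(9−d) − 1` bounds the columns). -/
def colKey (d K : ℕ) (o : List ℕ) : ℕ := keyGo (packRows o) K 0 d

/-- Arg-max of the key over a list of orderings (first one wins ties). -/
def bestGo (d K : ℕ) : List (List ℕ) → ℕ × List ℕ → List ℕ
  | [], best => best.2
  | o :: os, best => bestGo d K os (bif Nat.blt best.1 (colKey d K o) then (colKey d K o, o) else best)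

/-- An ordering of `R` with the largest key (among `R.permutations'`; only SOME ordering is needed). -/
def bestOrd (d : ℕ) (R : List ℕ) : List ℕ :=
  match R.permutations' with
  | [] => R
  | o :: os => bestGo d (Nat.sub (Nat.pow 2 (Nat.sub 9 d)) 1) os (colKey d (Nat.sub (Nat.pow 2 (Nat.sub 9 d)) 1) o, o)

/-- Stable rank count: columns `c'` (with running index `j`) below `(c, i)` in the order (value, index). -/
def rankGo : List ℕ → ℕ → ℕ → ℕ → ℕ
  | [], _, _, _ => 0
  | c' :: cs, c, i, j => Nat.add (bif Nat.blt c' c || (Nat.beq c' c && Nat.blt j i) then 1 else 0) (rankGo cs c i (j + 1))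

/-- Column codes `2^rank` for the columns `rest` (running index `i`) among all columns `cs`. -/
def pcGo (cs : List ℕ) : List ℕ → ℕ → List ℕ
  | [], _ => []
  | c :: rest, i => Nat.pow 2 (rankGo cs c i 0) :: pcGo cs rest (i + 1)

/-- The column codes of the coordinate permutation sorting the columns of an ordering (stable ranks; identity beyond `d`). -/
def permCols (d : ℕ) (o : List ℕ) : List ℕ := pcGo (cols d o) (cols d o) 0 ++ basis6.drop d

/-- The chosen coordinate permutation of the frame with free part `R` (column codes). -/
def bestPerm (d : ℕ) (R : List ℕ) : List ℕ := permCols d (bestOrd d R)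

/-- The linear map with column codes `P` on codes, as a fold over the columns (kernel-cheap twin of `linC`). -/
def linI : List ℕ → ℕ → ℕ
  | [], _ => 0
  | p :: ps, x => Nat.xor (bif Nat.beq (Nat.mod x 2) 1 then p else 0) (linI ps (Nat.div x 2))

/-- The image code list of the frame under a column list: `0`, the first `d` columns, the images of `R`. -/
def imgList (d : ℕ) (P R : List ℕ) : List ℕ := 0 :: (P.take d ++ R.map (linI P))

/-- The 64-bit membership mask of a code list. -/
def maskOf : List ℕ → ℕ
  | [] => 0
  | x :: l => Nat.lor (Nat.pow 2 x) (maskOf l)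

/-- The membership mask of the image of the frame `base d ∪ R` under the chosen permutation. -/
def frameMask (d : ℕ) (R : List ℕ) : ℕ := maskOf (imgList d (bestPerm d R) R)

/-- Boolean equality of code lists by `Nat.beq`. -/
def beqL : List ℕ → List ℕ → Bool
  | [], [] => true
  | x :: l, y :: m => Nat.beq x y && beqL l m
  | _, _ => false

/-- The column list sorts to the basis codes (so it is a permutation of them). -/
def sortsToBasis (P : List ℕ) : Bool := beqL (P.insertionSort fun a b => Nat.ble a b = true) basis6

/-! ## The bucketed table of listed canonical sets (by membership mask) -/

/-- The listed canonical code sets with frame dimension `d`, with their masks. -/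
def rowsM (d : ℕ) : List (ℕ × List ℕ) := (certs.filter fun row => row.1 == d).map fun row => (maskOf row.2.1, row.2.1)

/-- One bucket (mask mod `61 = b`) of `rowsM d`. -/
def bucketM (d b : ℕ) : List (ℕ × List ℕ) := (rowsM d).filter fun mc => Nat.beq (Nat.mod mc.1 61) b

/-- The 61 buckets as an `8 × 8` table (a closed term: evaluated once per kernel session). -/
def buckets (d : ℕ) : List (List (List (ℕ × List ℕ))) :=
  (List.range 8).map fun a => (List.range 8).map fun b => bucketM d (8 * a + b)

/-- Table lookup: the mask `m` is the mask of one of the listed canonical sets with this `d`. -/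
def lookupM (d m : ℕ) : Bool :=
  (((buckets d).getD (Nat.div (Nat.mod m 61) 8) []).getD (Nat.mod (Nat.mod m 61) 8) []).any fun mc => Nat.beq mc.1 m

/-- **The cover check of one frame** (free part `R` as a code list). -/
def coverOne (d : ℕ) (R : List ℕ) : Bool := sortsToBasis (bestPerm d R) && lookupM d (frameMask d R)

/-! ## Reading the check -/

/-- Bits of the mask are memberships. -/
theorem testBit_maskOf (l : List ℕ) (i : ℕ) : (maskOf l).testBit i = true ↔ i ∈ l := by
  induction l with
  | nil => simp [maskOf]
  | cons x l ih =>
    rw [maskOf, show Nat.lor (Nat.pow 2 x) (maskOf l) = 2 ^ x ||| maskOf l from rfl, Nat.testBit_or, Bool.or_eq_true, ih,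
      Nat.testBit_two_pow, decide_eq_true_eq, List.mem_cons, eq_comm]

/-- Code lists with the same mask describe the same set. -/
theorem setOf_eq_of_maskOf_eq {l₁ l₂ : List ℕ} (h : maskOf l₁ = maskOf l₂) : setOf l₁ = setOf l₂ := by
  have hm : ∀ x, x ∈ l₁ ↔ x ∈ l₂ := fun x => by rw [← testBit_maskOf, ← testBit_maskOf, h]
  ext y
  simp only [setOf, List.mem_toFinset, List.mem_map, hm]

/-- Reading `beqL`. -/
theorem eq_of_beqL : ∀ {l m : List ℕ}, beqL l m = true → l = m
  | [], [], _ => rfl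
  | x :: l, y :: m, h => by
    unfold beqL at h
    rw [Bool.and_eq_true] at h
    rw [Nat.eq_of_beq_eq_true h.1, eq_of_beqL h.2]
  | [], _ :: _, h => by simp [beqL] at h
  | _ :: _, [], h => by simp [beqL] at h

/-- A column list that sorts to the basis codes is a permutation of them. -/
theorem perm_of_sortsToBasis {P : List ℕ} (h : sortsToBasis P = true) : P.Perm basis6 := by
  have e := eq_of_beqL h
  rw [← e]
  exact (List.perm_insertionSort _ _).symm

/-- `List.getD` returns a member or the default. -/
theorem getD_mem_or {α : Type*} (L : List α) (n : ℕ) (x : α) : L.getD n x ∈ L ∨ L.getD n x = x := by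
  rw [List.getD_eq_getElem?_getD]
  cases h : L[n]? with
  | none => right; rfl
  | some y => left; exact List.mem_of_getElem? h

/-- Membership in a cell of a list-of-lists table read with `getD`. -/
theorem mem_of_mem_getD_getD {β : Type*} {T : List (List (List β))} {a b : ℕ} {x : β} (h : x ∈ (T.getD a []).getD b []) :
    ∃ row ∈ T, ∃ cell ∈ row, x ∈ cell := by
  rcases getD_mem_or T a [] with h1 | h1
  · rcases getD_mem_or (T.getD a []) b [] with h2 | h2
    · exact ⟨_, h1, _, h2, h⟩
    · rw [h2] at h; simp at h
  · rw [h1] at h; simp at h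

/-- Elements of the bucket table are listed rows. -/
theorem mem_certs_of_mem_buckets {d a b : ℕ} {mc : ℕ × List ℕ} (h : mc ∈ ((buckets d).getD a []).getD b []) :
    ∃ row ∈ certs, (maskOf row.2.1, row.2.1) = mc := by
  obtain ⟨trow, htrow, cell, hcell, hx⟩ := mem_of_mem_getD_getD h
  unfold buckets at htrow
  obtain ⟨a', _, rfl⟩ := List.mem_map.1 htrow
  obtain ⟨b', _, rfl⟩ := List.mem_map.1 hcell
  unfold bucketM at hx
  have hk' := (List.mem_filter.1 hx).1
  unfold rowsM at hk'
  obtain ⟨row, hrow, hmc⟩ := List.mem_map.1 hk'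
  exact ⟨row, (List.mem_filter.1 hrow).1, hmc⟩

/-- A hit of `lookupM` is the mask of a listed canonical set. -/
theorem lookupM_spec {d m : ℕ} (h : lookupM d m = true) : ∃ row ∈ certs, maskOf row.2.1 = m := by
  unfold lookupM at h
  obtain ⟨mc, hmc, hm⟩ := List.any_eq_true.1 h
  obtain ⟨row, hrow, hmc'⟩ := mem_certs_of_mem_buckets hmc
  refine ⟨row, hrow, ?_⟩
  rw [← hmc'] at hm
  exact Nat.eq_of_beq_eq_true hm

/-- The one-off checks of a column list `P`: `linOK`, `linI P = linC P` on codes `< 64`, basic codes ↦ `0 :: P.take d` (`d = 4, 5, 6`). -/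
def permOK (P : List ℕ) : Bool :=
  linOK P && (allC fun x => linI P x == linC P x) && [4, 5, 6].all fun d => (baseCodes d).map (linC P) == 0 :: P.take d

/-- KERNEL: every permutation of the basis codes passes `permOK` (720 lists). -/
theorem perms_ok : (basis6.permutations').all permOK = true := by decide +kernel

/-- Reading `perms_ok` for a column list that sorts to the basis codes. -/
theorem permOK_spec {P : List ℕ} (h : sortsToBasis P = true) : ∃ _ : linOK P = true,
    (∀ x < 64, linI P x = linC P x) ∧ ∀ d ∈ ({4, 5, 6} : Finset ℕ), (baseCodes d).map (linC P) = 0 :: P.take d := by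
  have hp := List.all_eq_true.1 perms_ok P (List.mem_permutations'.2 (perm_of_sortsToBasis h))
  unfold permOK at hp
  simp only [Bool.and_eq_true, List.all_eq_true] at hp
  obtain ⟨⟨h1, h2⟩, h3⟩ := hp
  refine ⟨h1, fun x hx => by simpa using allC_spec h2 hx, fun d hd => ?_⟩
  have hd' : d ∈ [4, 5, 6] := by simpa using hd
  simpa using h3 d hd'

/-- **Reading `coverOne`:** a checked column list `P` and a listed row whose canonical set is the image code set of the frame
`baseCodes d ++ R` under `linC P`. -/
theorem coverOne_spec {d : ℕ} (hd : d ∈ ({4, 5, 6} : Finset ℕ)) {R : List ℕ} (hR : ∀ x ∈ R, x < 64) (h : coverOne d R = true) :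
    ∃ P, ∃ _ : linOK P = true, ∃ row ∈ certs, setOf row.2.1 = setOf ((baseCodes d ++ R).map (linC P)) := by
  unfold coverOne at h
  rw [Bool.and_eq_true] at h
  obtain ⟨hP, hI, hB⟩ := permOK_spec h.1
  obtain ⟨row, hrow, hm⟩ := lookupM_spec h.2
  refine ⟨bestPerm d R, hP, row, hrow, ?_⟩
  rw [setOf_eq_of_maskOf_eq hm, List.map_append, hB d hd, imgList, List.cons_append,
    List.map_congr_left fun x hx => hI x (hR x hx)]

/-! ## Code sets versus finsets -/

/-- `setOf` of an appended list. -/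
theorem setOf_append (l₁ l₂ : List ℕ) : setOf (l₁ ++ l₂) = setOf l₁ ∪ setOf l₂ := by
  unfold setOf; rw [List.map_append, List.toFinset_append]

/-- `setOf` of a mapped code list (codes `< 64`) is the image under the linear map. -/
theorem setOf_map_linC {P : List ℕ} (hP : linOK P = true) {l : List ℕ} (hl : ∀ x ∈ l, x < 64) :
    setOf (l.map (linC P)) = (setOf l).image (lin P hP) := by
  ext y
  simp only [setOf, List.mem_toFinset, List.mem_map, Finset.mem_image]
  constructor
  · rintro ⟨_, ⟨x, hx, rfl⟩, rfl⟩
    exact ⟨dec x, ⟨x, hx, rfl⟩, by show linFun P (dec x) = _; unfold linFun; rw [enc_dec _ (hl x hx)]⟩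
  · rintro ⟨_, ⟨x, hx, rfl⟩, rfl⟩
    exact ⟨linC P x, ⟨x, hx, rfl⟩, by show _ = linFun P (dec x); unfold linFun; rw [enc_dec _ (hl x hx)]⟩

set_option synthInstance.maxSize 1024 in
/-- KERNEL: the code list `freeCodes d` describes `free d` (`d = 4, 5, 6`). -/
theorem mem_free_iff : ∀ d ∈ ({4, 5, 6} : Finset ℕ), ∀ x : G6, x ∈ free d ↔ enc x ∈ freeCodes d := by decide +kernel

set_option synthInstance.maxSize 1024 in
/-- KERNEL: the code list `baseCodes d` describes `base d` (`d = 4, 5, 6`). -/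
theorem setOf_baseCodes : ∀ d ∈ ({4, 5, 6} : Finset ℕ), setOf (baseCodes d) = base d := by decide +kernel

/-- Codes in `freeCodes d` are `< 64` (`d ≤ 6`). -/
theorem lt_of_mem_freeCodes {d : ℕ} (hd : d ≤ 6) {n : ℕ} (hn : n ∈ freeCodes d) : n < 64 := by
  unfold freeCodes at hn
  have h := List.mem_range.1 (List.mem_filter.1 hn).1
  exact lt_of_lt_of_le h (Nat.pow_le_pow_right (by norm_num) hd)

/-- Codes in `baseCodes d` are `< 64` (`d ≤ 6`). -/
theorem lt_of_mem_baseCodes {d : ℕ} (hd : d ≤ 6) {n : ℕ} (hn : n ∈ baseCodes d) : n < 64 := by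
  unfold baseCodes at hn
  rcases List.mem_cons.1 hn with rfl | hn
  · norm_num
  · obtain ⟨j, hj, rfl⟩ := List.mem_map.1 hn
    exact lt_of_lt_of_le (Nat.pow_lt_pow_right (by norm_num) (List.mem_range.1 hj)) (Nat.pow_le_pow_right (by norm_num) hd)

/-- `freeCodes d` is increasing. -/
theorem freeCodes_sorted (d : ℕ) : (freeCodes d).Pairwise (· ≤ ·) :=
  (List.pairwise_lt_range.filter _).imp fun h => Nat.le_of_lt h

end T1Z2p6

end Summit.MatrixMultiplication.OmegaCensus
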